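import Summits.HodgeConjecture.HodgeConjecture.Theorems.R90S10LocalGlobaliseUDefs          -- ★-cand (DEFS DOWN, law L9): `LocalTransportStBetaLetter` (U2), `AuxGlobaliseFieldCharLetter` (U3-F∧χ = G0), `AuxGlobaliseTorusLetter` (U3-ξ)
import Summits.HodgeConjecture.HodgeConjecture.Cruxes.H413.Lines.R90_S10_SimpleTF1383A          -- S10 FILE A (ED. 9 WRITTEN 02:51:46Z, d48318842039a135): HEAD₃ of record `e1St1383Unr_paid₃` :1390
import Summits.HodgeConjecture.HodgeConjecture.Cruxes.H413.Lines.R90_S3_LocalTransportWaveG2     -- S3 FILE G2 = PATH-PROBE TWIN «G-LITE» of G ED. 6″ (§1–§3, RULING S3-R34′; f96c61156038d963, BUILT K132 03:46:28Z; «CANONICAL FOR CONSUMERS … S10 U»): G0 `R90.S3.stub_R90_S3_auxGlobalise` :755 (bytes ≡ G :746)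
import Summits.HodgeConjecture.HodgeConjecture.Theorems.R90S10StSpectralHypAtTransport     -- ★ p863791 (p06 (g0)): `R90.S10.stSpectralHypAt_of_transport (hG1) : LocalTransportStBetaLetter` ((U2) head)
import Summits.HodgeConjecture.HodgeConjecture.Theorems.R90S3TransportDelta              -- ★ p863454 (K2E4-p14 (g12)): `R90.S3.finExplicitDelta_transport` (= S3's G1, binders verbatim) pays `hG1`
import Summits.HodgeConjecture.HodgeConjecture.Theorems.R90S10AuxGlobaliseTorusLetterHolds  -- ★ p01 (g0): `R90.S10.auxGlobaliseTorusLetter_holds : AuxGlobaliseTorusLetter` ((U3-ξ) PROVED, body ★ `auxGlobaliseTorus`)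
import Summits.HodgeConjecture.HodgeConjecture.Theorems.K2E1StSpectralHypAtOfSt1383At       -- ★ p862620 (U1-E1): `StSpectralHypAt`, `E1St1383LetterUnr`, `stSpectralHypUnr_of_unr` (transitive; explicit)
import HarnessLib

/-!
# R90-TF ∕ S10 — FILE U: «(U-loc) LOCAL TRANSPORT + AUXILIARY GLOBALISATION» — the organ letter ★ `StSpectralHypLetter` from E1's RESTRICTED letter

Cell hodgecm-mathlib, slab R90-TF, section S10 = Rogawski 1990 §13.8, crux item h413 = stmt-HodgeConjecture-24833 (route `route-HodgeConjecture-HCCMUnconditional`).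
Pen: R90-C138-typ1 (g3) (LEAD #32 (H) 22:23:06Z; plan «=» 22:22:34Z; LEAD #34 (B)(D) 22:36:52Z; S3-R12 22:36:55Z).  By-write on 24833 (`ledger crux write … Lines/…` only;
NO `skeleton check`; registries untouched).

THE CHAIN OF RECORD (LEAD #32 (H)): `E1St1383LetterUnr ⟹ (∀ ⟪U⟫′-instances, StSpectralHypAt) ⟹[(U3) globalise + (U2) transport] StSpectralHypLetter`, i.e. the organ
(S-β) ★ `StSpectralHypLetter` (★ `Theorems/K2E1TraceFormulaBetaDefs.lean` :92–:120, consumed by ★ `K2_E1_TraceFormulaBeta` §A `stSpectralHyp_of_line`) follows from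
E1's St-(13.8.3) letter RESTRICTED to print's regime ⟪U⟫′ (★ `E1St1383LetterUnr`, paid by S10 FILE A's head of record `e1St1383Unr_paid₃` modulo A's ₃-cone) and TWO SOCKETS:
* `sock_S10_localTransportStBeta : LocalTransportStBetaLetter` — (U2) LOCAL TRANSPORT of the pointwise organ letter along S3's unbundled local-transport datum + the
  two torus-character binders (payer: S3 WAVE 4 bricks G1–G4 `Cruxes/H413/Lines/R90_S3_LocalTransportWaveG.lean` + S10's carriers; Theorems hand `--supports 24833`);
* `sock_S10_auxGlobaliseFieldChar : AuxGlobaliseFieldCharLetter` — (U3-F∧χ) = S3's consumer-facing G0 `R90.S3.stub_R90_S3_auxGlobalise` AS A PROP, BYTE-FOR-BYTE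
  (tree G ED. 6″ 1b07be61a4375837 :746 ≡ its BUILT path-probe twin G2 f96c61156038d963 :755, the module imported here per RULING S3-R34′; junction J-S10∕S3-U, ONE
  spelling): PAID BY NAME here (G0 is itself the sorry-free composition of S3's (U3-F) `stub_R90_S3_auxGlobaliseField` + (U3-χ) `stub_R90_S3_auxGlobaliseChar`,
  LEAD #34 (B) — both ★-plugged since G ED. 6″ ∕ G2, whose `sorry` count is 0; the price is counted once, at S3);
* `sock_S10_auxGlobaliseTorus : AuxGlobaliseTorusLetter` — (U3-ξ) globalisation of ξ's torus characters `η_v, ψ_v` along the same datum (S10's own third of (U3); payer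
  later, elementary, NOT FLOOR, size M–L; road of record `R90/S10/C138-typ1-g3/U3-GLOBALISATION-SKETCH.v1.md` §3).
HEADS (sorry-free, kernel-checked): §3 `e1St1383LetterUnr_of_A` ((F2) reshuffle of FILE A's BUILT head) and `stSpectralHypLetter_paid_of_A :
StSpectralHypLetter` (head of record modulo every S10 socket); §2 `stSpectralHypLetter_of_unrAt` (the composition over hypotheses), `stSpectralHypLetter_of_unr : E1St1383LetterUnr →
LocalTransportStBetaLetter → AuxGlobaliseFieldCharLetter → AuxGlobaliseTorusLetter → StSpectralHypLetter` (LEAD #32 (H)'s shape with (U3) = LEAD #34 (B)'s two sockets, via ★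
`stSpectralHypUnr_of_unr`), `stSpectralHypLetter_of_unr_paid : E1St1383LetterUnr → StSpectralHypLetter` (modulo the three sockets).  ED. 2 (additions only, after FILE A is BUILT): `import …Lines.R90_S10_SimpleTF1383A` + the 3-line
reshuffle `e1St1383LetterUnr_of_A : ‹A's sockets› → E1St1383LetterUnr` ((F2), LEAD #34 (A)) + `stSpectralHypLetter_paid_of_A`.
NO RESTATEMENT: ★ `StSpectralHypLetter`, ★ `StSpectralHypAt`, ★ `E1St1383LetterUnr` are consumed BY NAME; the `example` at the end is the `Iff.rfl` junction certificate.


**ED. 3 (= ED. 3b + G0 BY NAME through S3's BUILT twin module `…Lines.R90_S3_LocalTransportWaveG2`, statements byte-frozen; dealer R90-C138-plan (g3) 02:18:46Z ∕ 02:39:06Z (4),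
S3 RULING S3-R34′): ALL THREE SOCKETS PAID and (F2) re-pointed at A's HEAD₃ OF RECORD
`e1St1383Unr_paid₃` (A ED. 9; statement byte-identical to `e1St1383Unr_paid` ∕ `…_paid₂`, 3232 chars; one token in the body of `e1St1383LetterUnr_of_A`).** (U2) — `sock_S10_localTransportStBeta :=
stSpectralHypAt_of_transport R90.S3.finExplicitDelta_transport` (★ `Theorems/R90S10StSpectralHypAtTransport.lean`, prover p06 (g0); ★ `Theorems/R90S3TransportDelta.lean` pays its
`hG1`; RULING J-U2-2); (U3-ξ) — `sock_S10_auxGlobaliseTorus := auxGlobaliseTorusLetter_holds` (★ `Theorems/R90S10AuxGlobaliseTorusLetterHolds.lean`, prover p01 (g0); body ★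
`auxGlobaliseTorus`); (U3-F∧χ) — BY NAME from tree G's G0, `sock_S10_auxGlobaliseFieldChar := … R90.S3.stub_R90_S3_auxGlobalise …` (its price = whatever S3's (U3-F) + (U3-χ) cost at the imported edition — G2 ∕ G ED. 6″: 0 `sorry`,
counted once at S3; the only `Cruxes/…/Lines` import kept for a payment).  Sorry census of this file: 0 — `stSpectralHypLetter_paid_of_A : StSpectralHypLetter` is now
★ `StSpectralHypLetter` modulo exactly A's ₃-cone (via `e1St1383Unr_paid₃`; today = the ₂-cone): A2a₂ `sock_S10_realiseH₂`, B₂ `sock_S10_stabilisedAtEvp₂` (Lines B), 6b `sock_S10_archFinSplitG3`,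
floor `stub_R90_ext_hcFiniteLevel`, EXT `stub_R90_ext_unitFL₂` (+ E1 12R3 by name inside A2d) — G0 and its module G2 are sorry-free.  Closes nothing by fiat.
HONEST LABEL: this file (ED. 3) has 0 `sorry`: (U2) and (U3-ξ) are PAID by ★ theorems, (U3-F∧χ) BY NAME from S3's G0 (module G2, itself sorry-free); it proves only logic; HC_CM is proved only modulo the 7 printed citations (2 remaining named inputs:
hLiu418 = stmt-HodgeConjecture-24832, h413 = stmt-HodgeConjecture-24833) until rung 0 closes; REL ≠ ★ ≠ BUILT.
[Rogawski1990] §13.8 pp. 217–219; §14.2 p. 232.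
-/

set_option autoImplicit false
set_option linter.dupNamespace false

open NumberField IsDedekindDomain
open Literature.NumberTheory.Rogawski1990 Literature.NumberTheory.Automorphic Literature.NumberTheory.Automorphic.UnitaryGroup
open Literature.NumberTheory.GaloisRepresentations
open Summit.HodgeConjecture.HodgeConjecture.Cruxes.H413.K2E1TraceFormulaBeta (Pl StSpectralHypLetter)
open Summit.HodgeConjecture.HodgeConjecture.Cruxes.H413.K2E1StSpectralHypAtOfSt1383At (St1383At StSpectralHypAt E1St1383LetterUnr stSpectralHypUnr_of_unr)

namespace Summit.HodgeConjecture.HodgeConjecture.R90.S10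

/-! ## §1 THE SOCKETS — ALL PAID: (U2) ★ `stSpectralHypAt_of_transport` + ★ `finExplicitDelta_transport`; (U3-F∧χ) BY NAME from G0; (U3-ξ) ★ `auxGlobaliseTorusLetter_holds` -/

/-- **(U2) — local transport of the organ (S-β), PAID** (type ★ `LocalTransportStBetaLetter`): by ★ `stSpectralHypAt_of_transport` (prover R90-C138-p06 (g0),
`Theorems/R90S10StSpectralHypAtTransport.lean` — naturality of every token of `StSpectralHypAt` under S3's datum, S3 bricks G2 G5 G6 ★ + S10 carriers ★) applied to
★ `R90.S3.finExplicitDelta_transport` (the transported transfer factor `Δ‴`, S3's G1 as a theorem; RULING J-U2-2). [cite: Rogawski1990, §14.2 p. 232; §13.8 p. 217 l. 9] -/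
theorem sock_S10_localTransportStBeta : LocalTransportStBetaLetter :=
  stSpectralHypAt_of_transport Summit.HodgeConjecture.HodgeConjecture.R90.S3.finExplicitDelta_transport

/-- **(U3-F∧χ) — S3's G0 as a Prop, PAID BY NAME** (type ★-cand `AuxGlobaliseFieldCharLetter` = `R90.S3.stub_R90_S3_auxGlobalise`'s statement byte-for-byte; G is in tree,
so the junction J-S10∕S3-U is discharged here and now: two lines, no `sorry` of its own — the arithmetic content sits in G's (U3-F) `stub_R90_S3_auxGlobaliseField` and (U3-χ)
`stub_R90_S3_auxGlobaliseChar`, both ★-plugged at G ED. 6″ ∕ G2 (`R90S3AuxGlobaliseFieldOfDenseCM` + `R90S3PlantedDenseCM`; `R90S3AuxGlobaliseCharKey`), counted ONCE, at S3). A GENUINE arithmetic input, the declared price of (β), NOT FLOOR.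
[cite: Rogawski1990, §13.8 p. 217 l. 9, p. 218 l. 9] -/
theorem sock_S10_auxGlobaliseFieldChar : AuxGlobaliseFieldCharLetter := by
  intro L _ _ _ v μ hμu hμω hv
  exact Summit.HodgeConjecture.HodgeConjecture.R90.S3.stub_R90_S3_auxGlobalise L v μ hμu hμω hv

/-- **(U3-ξ) — globalisation of ξ's torus characters, PAID** (type ★ `AuxGlobaliseTorusLetter`): by ★ `auxGlobaliseTorusLetter_holds` (prover R90-C138-p01 (g0);
body ★ `auxGlobaliseTorus` — Hilbert-90 torus dictionary + extension of characters from the compact non-split local torus). [cite: Rogawski1990, §13.8 p. 217 l. 9–12] -/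
theorem sock_S10_auxGlobaliseTorus : AuxGlobaliseTorusLetter :=
  auxGlobaliseTorusLetter_holds

/-! ## §2 THE COMPOSITION (sorry-free) -/

/-- **COMPOSITION**: the pointwise ⟪U⟫′-restricted organ letter (⟪U⟫ then `h3`, the (F1) order of ★ `stSpectralHypUnr_of_unr`) + (U2) + (U3-F∧χ) + (U3-ξ) ⟹ ★ `StSpectralHypLetter`.
[cite: Rogawski1990, §13.8 pp. 217–219] -/
theorem stSpectralHypLetter_of_unrAt
    (hUnr : ∀ (L : Type) [Field L] [NumberField L] [IsCMField L] (μ : HeckeCharacter L) (ξ : OneDimAutRepH L) (v : Pl L),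
      (∀ w : Pl L, w ≠ v → ∀ W : PlacesOver L w, Algebra.IsUnramifiedAt (𝓞 ↥(maximalRealSubfield L)) W.1.asIdeal ∧ μ.IsUnramifiedAt W.1) →
      (3 ≤ Module.finrank ℚ ↥(maximalRealSubfield L)) → StSpectralHypAt L μ ξ v)
    (hU2 : LocalTransportStBetaLetter) (hU3 : AuxGlobaliseFieldCharLetter) (hU3ξ : AuxGlobaliseTorusLetter) : StSpectralHypLetter := by
  intro L _ _ _ μ ξ v
  change StSpectralHypAt L μ ξ v
  intro hns hμu hμω
  obtain ⟨L', _iF, _iN, _iC, v', Φ, μ', hc, hc', hΦσ, hμ'u, hμ'ω, hΦμ, hU', h3', hns'⟩ := hU3 L v μ hμu hμω hns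
  obtain ⟨ξ', hΦη, hΦψ⟩ := hU3ξ L ξ v L' v' Φ hc hc' hΦσ hns'
  exact hU2 L μ ξ v L' μ' ξ' v' Φ hc hc' hΦσ hΦμ hΦη hΦψ hns' hμ'u hμ'ω (hUnr L' μ' ξ' v' hU' h3') hns hμu hμω

/-- **HEAD (LEAD #32 (H)'s shape, (U3) = LEAD #34 (B)'s two sockets): `E1St1383LetterUnr → ‹U2› → ‹U3-F∧χ› → ‹U3-ξ› → StSpectralHypLetter`**, via ★ `stSpectralHypUnr_of_unr`
((U1-E1) §4). [cite: Rogawski1990, §13.8 pp. 217–219] -/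
theorem stSpectralHypLetter_of_unr (hE1 : E1St1383LetterUnr) (hU2 : LocalTransportStBetaLetter) (hU3 : AuxGlobaliseFieldCharLetter)
    (hU3ξ : AuxGlobaliseTorusLetter) : StSpectralHypLetter :=
  stSpectralHypLetter_of_unrAt (fun L _ _ _ μ ξ v hU h3 => stSpectralHypUnr_of_unr hE1 L μ ξ v hU h3) hU2 hU3 hU3ξ

/-- **HEAD OF RECORD modulo the sockets**: E1's RESTRICTED letter suffices for the organ letter. [cite: Rogawski1990, §13.8 pp. 217–219] -/
theorem stSpectralHypLetter_of_unr_paid (hE1 : E1St1383LetterUnr) : StSpectralHypLetter :=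
  stSpectralHypLetter_of_unr hE1 sock_S10_localTransportStBeta sock_S10_auxGlobaliseFieldChar sock_S10_auxGlobaliseTorus

/-! ## §3 THE (F2) RESHUFFLE AGAINST FILE A's HEAD₃ OF RECORD + THE HEAD OF RECORD MODULO THE ₃-CONE (LEAD #34 (F2); dealer 02:18:46Z ∕ 02:39:06Z) -/

/-- **(F2)**: FILE A's restricted HEAD₃ OF RECORD `e1St1383Unr_paid₃` (⟪U⟫, `h3` AFTER the three global lines, RULING R-U2; the guarded ₂-road at S2's
`CuspG₀ ∕ CuspH₀`, A ED. 9; statement byte-identical to the one-place head `e1St1383Unr_paid` and to `…_paid₂`) pays ★ `E1St1383LetterUnr` (⟪U⟫, `h3` BEFORE `St1383At`, the (U1-E1)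
order) — a binder reshuffle, no content. [cite: Rogawski1990, §13.8 pp. 217–219] -/
theorem e1St1383LetterUnr_of_A : E1St1383LetterUnr := by
  intro L _ _ _ μ ξ v hU h3 hns hμu hμω
  exact e1St1383Unr_paid₃ L μ ξ v hns hμu hμω hU h3

/-- **HEAD OF RECORD of the (U-loc) chain**: ★ `StSpectralHypLetter` (E1's organ hypothesis for (S-β), consumed BY NAME) modulo FILE A's ₃-cone (A ED. 9: fed exactly as HEAD₂) {A2a₂ `sock_S10_realiseH₂`, 6b `sock_S10_archFinSplitG3`,
floor, EXT `stub_R90_ext_unitFL₂`} and FILE B's B₂ `sock_S10_stabilisedAtEvp₂` (G0 and its module G2 being sorry-free) — `--axioms` census = those `sorryAx` only ((U2), (U3-ξ) are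
★-paid, (U3-F∧χ) by name; the one-place A2a ∕ A2c ∕ B1 are OFF this cone). Closes nothing by fiat. [cite: Rogawski1990, §13.8 pp. 217–219] -/
theorem stSpectralHypLetter_paid_of_A : StSpectralHypLetter :=
  stSpectralHypLetter_of_unr_paid e1St1383LetterUnr_of_A

/-- JUNCTION CERTIFICATE: the organ letter read back (`Iff.rfl`; no restatement of ★ `StSpectralHypLetter` in this file). -/
example : StSpectralHypLetter ↔ ∀ (L : Type) [Field L] [NumberField L] [IsCMField L] (μ : HeckeCharacter L) (ξ : OneDimAutRepH L) (v : Pl L),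
    StSpectralHypAt L μ ξ v := Iff.rfl

end Summit.HodgeConjecture.HodgeConjecture.R90.S10
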